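import Mathlib.NumberTheory.Padics.RingHoms
import Mathlib.RingTheory.PowerSeries.Inverse
import Mathlib.RingTheory.DiscreteValuationRing.TFAE
import Mathlib.RingTheory.PowerSeries.NoZeroDivisors
import Literature.NumberTheory.EllipticCurves.IwasawaAlgebra
import HarnessLib

/-!
# Layer rigidity, part V: the LAYER COEFFICIENT RING `ℤ_p⟦T⟧/(φ)` for a PRIME `φ` with `v_p(φ(0)) = 1` (every Eisenstein layer relation
# `Φ_{p^{n+1}}(1+T)`, part IV) is a DISCRETE VALUATION RING with uniformiser `T mod φ` — generalising the tree's Howard case `φ = T^m + p`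
# (`IwasawaAlgebra.isDiscreteValuationRing_quotient_X_pow_add_C`)

Cell `bsd-print-cf2`, width seat `bsd-line-cf2c-w8` g6 (prover-bsd-line-cf2c-w8-g6-0); memo `Cruxes/MainConjClauseAtSplitTwoQuad/A-BRICK-PRINT-MAP-cf2c-w8g6.md` §6,
piece (i) of the open (C^alg) «generic specialisation» of the rigidity road: the layer ring `Λ₂/(C φ) ≅ (ℤ_p⟦T₂⟧/φ)⟦T₁⟧` is power series over THIS ring, so
its regularity/UFD (tree `isRegularLocalRing_mvPowerSeries_dvr`, `uniqueFactorizationMonoid_of_isRegularLocalRing`) starts here. For `φ ∈ ℤ_p⟦T⟧` PRIME with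
constant coefficient `p·(unit)`: `mk_X_ne_zero_of_prime` (`φ ∤ T`), `not_isUnit_mk_X_of_constantCoeff` (`T` is not a unit mod `φ`), `isLocalRing_quotient_span`,
**`maximalIdeal_quotient_span_eq`** (the maximal ideal of `ℤ_p⟦T⟧/(φ)` is `(T̄)`: a non-unit `a` has `a(0) = p b`, and `p ≡ −T·φ′·u⁻¹ (mod φ)`),
`not_isField_quotient_span`, **`isDiscreteValuationRing_quotient_span`** (Mathlib `IsDiscreteValuationRing.TFAE`), `irreducible_mk_X_of_prime`.
Pure algebra; THEOREMS ONLY; no `def`, no named fact, no `sorry`. No summit statement is proved; BSD is not proved by any of this. beyond-print theorem: no.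

References: [Washington1997] §7.1 (Eisenstein / distinguished polynomials), §13.2; [SerreLocalFields1979] I §6 (totally ramified extensions, Eisenstein equations).
-/

set_option autoImplicit false
-- the summit namespace `Summit.BirchSwinnertonDyer.BirchSwinnertonDyer` repeats the problem name by design (D-0017)
set_option linter.dupNamespace false

open PowerSeries

namespace Summit.BirchSwinnertonDyer.BirchSwinnertonDyer.Theorems.PrintCf2.LayerRigidity

variable {p : ℕ} [hp : Fact p.Prime]

section EisensteinQuotient

variable {φ : PowerSeries ℤ_[p]} {u : ℤ_[p]ˣ}

/-- `φ ∤ T` when `φ` is a non-unit with `φ(0) ≠ 0`: so `T̄ ≠ 0` in `ℤ_p⟦T⟧/(φ)`. [cite: Washington1997, §7.1] -/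
theorem mk_X_ne_zero_of_not_isUnit (hφu : ¬ IsUnit φ) (h0 : constantCoeff φ ≠ 0) :
    Ideal.Quotient.mk (Ideal.span {φ}) (X : PowerSeries ℤ_[p]) ≠ 0 := by
  rw [Ne, Ideal.Quotient.eq_zero_iff_mem, Ideal.mem_span_singleton]
  rintro ⟨g, hg⟩
  -- constant coefficients: `0 = φ(0) g(0)`, so `g(0) = 0`, `g = T g'`, `T = φ T g'`, `1 = φ g'`
  have hg0 : constantCoeff g = 0 := by
    have h := congrArg constantCoeff hg
    rw [constantCoeff_X, map_mul] at h
    exact (mul_eq_zero.mp h.symm).resolve_left h0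
  obtain ⟨g', rfl⟩ : X ∣ g := by rw [X_dvd_iff]; exact hg0
  apply hφu
  have h1 : (X : PowerSeries ℤ_[p]) * (1 - φ * g') = 0 := by rw [mul_sub, mul_one, sub_eq_zero]; rw [← mul_assoc, mul_comm φ X, mul_assoc] at hg; exact hg
  rcases mul_eq_zero.mp h1 with h | h
  · exact absurd h X_ne_zero
  · exact IsUnit.of_mul_eq_one g' (by linear_combination (-1 : PowerSeries ℤ_[p]) * h)

/-- `T` is NOT a unit modulo `φ` when `p ∣ φ(0)`: a relation `T a − 1 = φ b` gives `−1 = φ(0) b(0) ∈ pℤ_p`. [cite: Washington1997, §7.1] -/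
theorem not_isUnit_mk_X_of_constantCoeff (h0 : constantCoeff φ = (p : ℤ_[p]) * u) :
    ¬ IsUnit (Ideal.Quotient.mk (Ideal.span {φ}) (X : PowerSeries ℤ_[p])) := by
  intro hX
  obtain ⟨v, hv⟩ := IsUnit.exists_right_inv hX
  obtain ⟨a, rfl⟩ := Ideal.Quotient.mk_surjective v
  rw [← map_mul, ← (Ideal.Quotient.mk _).map_one, Ideal.Quotient.eq, Ideal.mem_span_singleton] at hv
  obtain ⟨b, hb⟩ := hv
  have hc := congrArg constantCoeff hb
  rw [map_sub, map_mul, constantCoeff_X, zero_mul, map_one, map_mul, h0] at hc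
  have h1 : (p : ℤ_[p]) * (-(u * constantCoeff b)) = 1 := by linear_combination hc
  exact PadicInt.irreducible_p.not_isUnit (IsUnit.of_mul_eq_one _ h1)

/-- `ℤ_p⟦T⟧/(φ)` is local for a non-unit `φ` (non-trivial quotient of a local ring). [cite: Washington1997, §13.2] -/
theorem isLocalRing_quotient_span (hφu : ¬ IsUnit φ) : IsLocalRing (PowerSeries ℤ_[p] ⧸ Ideal.span {φ}) := by
  haveI : Nontrivial (PowerSeries ℤ_[p] ⧸ Ideal.span {φ}) :=
    Ideal.Quotient.nontrivial_iff.mpr (by rw [Ne, Ideal.span_singleton_eq_top]; exact hφu)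
  exact IsLocalRing.of_surjective' (Ideal.Quotient.mk _) Ideal.Quotient.mk_surjective

/-- **The maximal ideal of `ℤ_p⟦T⟧/(φ)` is `(T̄)`** when `φ(0) = p·(unit)`: a non-unit `a mod φ` has `a(0) = p b` (else `a = unit + T a′` is a unit), and
`p·u = φ − T φ′`, so `a ≡ T·(a′ − φ′ u⁻¹ b) (mod φ)`. [cite: Washington1997, §7.1] [cite: SerreLocalFields1979, I §6] -/
theorem maximalIdeal_quotient_span_eq (hφu : ¬ IsUnit φ) (h0 : constantCoeff φ = (p : ℤ_[p]) * u) :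
    @IsLocalRing.maximalIdeal _ _ (isLocalRing_quotient_span hφu) = Ideal.span {Ideal.Quotient.mk (Ideal.span {φ}) (X : PowerSeries ℤ_[p])} := by
  letI := isLocalRing_quotient_span hφu
  apply le_antisymm
  · intro s hs
    rw [IsLocalRing.mem_maximalIdeal, mem_nonunits_iff] at hs
    obtain ⟨a, rfl⟩ := Ideal.Quotient.mk_surjective s
    -- `a = C a₀ + X a'`, `φ = C φ₀ + X φ'`
    have hsplit : ∀ c : PowerSeries ℤ_[p], ∃ c' : PowerSeries ℤ_[p], c = C (constantCoeff c) + X * c' := fun c ↦ by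
      have hdvd : (X : PowerSeries ℤ_[p]) ∣ c - C (constantCoeff c) := by rw [X_dvd_iff, map_sub, constantCoeff_C, sub_self]
      obtain ⟨c', h⟩ := hdvd
      exact ⟨c', by rw [← h]; ring⟩
    obtain ⟨a', ha'⟩ := hsplit a
    obtain ⟨φ', hφ'⟩ := hsplit φ
    have ha0 : ¬ IsUnit (constantCoeff a) := by
      intro hu
      apply hs
      have hXmem : Ideal.Quotient.mk (Ideal.span {φ}) (X * a') ∈ IsLocalRing.maximalIdeal _ := by
        rw [map_mul]
        exact Ideal.mul_mem_right _ _ ((IsLocalRing.mem_maximalIdeal _).mpr (not_isUnit_mk_X_of_constantCoeff h0))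
      have hCunit : IsUnit (Ideal.Quotient.mk (Ideal.span {φ}) (C (constantCoeff a))) := (hu.map C).map _
      by_contra hnot
      have hmem : Ideal.Quotient.mk _ a ∈ IsLocalRing.maximalIdeal _ := (IsLocalRing.mem_maximalIdeal _).mpr hnot
      rw [ha', map_add] at hmem
      have hC := Submodule.sub_mem _ hmem hXmem
      rw [add_sub_cancel_right] at hC
      exact (IsLocalRing.mem_maximalIdeal _).mp hC hCunit
    have ha0' : constantCoeff a ∈ IsLocalRing.maximalIdeal ℤ_[p] := (IsLocalRing.mem_maximalIdeal _).mpr ha0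
    rw [PadicInt.maximalIdeal_eq_span_p, Ideal.mem_span_singleton] at ha0'
    obtain ⟨b, hb⟩ := ha0'
    -- `C p = (φ − X φ') · C u⁻¹`, so `C a₀ = C p · C b ≡ −X φ' C (u⁻¹ b)`
    rw [Ideal.mem_span_singleton]
    refine ⟨Ideal.Quotient.mk _ (a' - φ' * C ((u⁻¹ : ℤ_[p]ˣ) * b)), ?_⟩
    rw [← map_mul, Ideal.Quotient.eq, Ideal.mem_span_singleton]
    refine ⟨C ((u⁻¹ : ℤ_[p]ˣ) * b), ?_⟩
    have hpu : C (p : ℤ_[p]) = (φ - X * φ') * C ((u⁻¹ : ℤ_[p]ˣ) : ℤ_[p]) := by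
      have : C (constantCoeff φ) = φ - X * φ' := by linear_combination (-1 : PowerSeries ℤ_[p]) * hφ'
      rw [← this, h0, map_mul, mul_assoc, ← map_mul, Units.mul_inv, map_one, mul_one]
    rw [ha', hb, map_mul, hpu, map_mul]
    ring
  · rw [Ideal.span_singleton_le_iff_mem]
    exact (IsLocalRing.mem_maximalIdeal _).mpr (not_isUnit_mk_X_of_constantCoeff h0)

/-- `ℤ_p⟦T⟧/(φ)` is not a field (`0 ≠ T̄ ∈ 𝔪`). [cite: Washington1997, §13.2] -/
theorem not_isField_quotient_span (hφu : ¬ IsUnit φ) (h0 : constantCoeff φ = (p : ℤ_[p]) * u) :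
    ¬ IsField (PowerSeries ℤ_[p] ⧸ Ideal.span {φ}) := by
  letI := isLocalRing_quotient_span hφu
  have h0' : constantCoeff φ ≠ 0 := by
    rw [h0]; exact mul_ne_zero (by exact_mod_cast hp.out.ne_zero) u.ne_zero
  rw [IsLocalRing.isField_iff_maximalIdeal_eq, maximalIdeal_quotient_span_eq hφu h0, Ideal.span_singleton_eq_bot]
  exact mk_X_ne_zero_of_not_isUnit hφu h0'

/-- **`ℤ_p⟦T⟧/(φ)` IS A DISCRETE VALUATION RING** for `φ` PRIME with `φ(0) = p·(unit)` (every Eisenstein layer relation `Φ_{p^{n+1}}(1+T)` of part IV):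
a Noetherian local domain, not a field, with principal maximal ideal `(T̄)`. [cite: SerreLocalFields1979, I §6] [cite: Washington1997, §7.1, §13.2] -/
theorem isDiscreteValuationRing_quotient_span (hφ : Prime φ) (h0 : constantCoeff φ = (p : ℤ_[p]) * u) :
    @IsDiscreteValuationRing (PowerSeries ℤ_[p] ⧸ Ideal.span {φ}) _
      ((Ideal.Quotient.isDomain_iff_prime _).mpr ((Ideal.span_singleton_prime hφ.ne_zero).mpr hφ)) := by
  letI : IsDomain (PowerSeries ℤ_[p] ⧸ Ideal.span {φ}) := (Ideal.Quotient.isDomain_iff_prime _).mpr ((Ideal.span_singleton_prime hφ.ne_zero).mpr hφ)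
  letI := isLocalRing_quotient_span hφ.not_unit
  have h := IsDiscreteValuationRing.TFAE (PowerSeries ℤ_[p] ⧸ Ideal.span {φ}) (not_isField_quotient_span hφ.not_unit h0)
  refine (h.out 0 4).mpr ?_
  rw [maximalIdeal_quotient_span_eq hφ.not_unit h0]
  exact ⟨⟨_, rfl⟩⟩

/-- `T̄` is a uniformiser of the DVR `ℤ_p⟦T⟧/(φ)`. [cite: SerreLocalFields1979, I §6] -/
theorem irreducible_mk_X_of_prime (hφ : Prime φ) (h0 : constantCoeff φ = (p : ℤ_[p]) * u) :
    Irreducible (Ideal.Quotient.mk (Ideal.span {φ}) (X : PowerSeries ℤ_[p])) := by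
  letI : IsDomain (PowerSeries ℤ_[p] ⧸ Ideal.span {φ}) := (Ideal.Quotient.isDomain_iff_prime _).mpr ((Ideal.span_singleton_prime hφ.ne_zero).mpr hφ)
  letI := isLocalRing_quotient_span hφ.not_unit
  letI := isDiscreteValuationRing_quotient_span hφ h0
  exact (IsDiscreteValuationRing.irreducible_iff_uniformizer _).mpr (maximalIdeal_quotient_span_eq hφ.not_unit h0)

end EisensteinQuotient

end Summit.BirchSwinnertonDyer.BirchSwinnertonDyer.Theorems.PrintCf2.LayerRigidity
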